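import Literature.Barriers.QuantumAdvantage.TensorNetworkContractionSegments
import Literature.Computability.QuantumComplexity.ZWRing
import HarnessLib

/-!
# Barrier catalogue `QuantumAdvantage` — the integer tables of the segment network (exact arithmetic in `ℤ[ω]` for Markov–Shi's contraction)

Companion to `TensorNetworkContractionSegments.lean` (the segment tensor network
`N(C; z₀, obs)` of a circuit, whose value is the Born weight — Markov–Shi Prop. 3.5 — in
particular `acceptProb_eq_value_segmentNetwork`). The contraction engine of Steps 3–4 of the
proof of Markov–Shi's Thm 4.6 contracts `N(C; x, τ)` with EXACT arithmetic: for an oracle-free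
Clifford+`T` circuit every entry of every tensor of `N(C; x, τ)` — `(U_t)_{out,in}·conj (U_t)_{out',in'}`
for a gate, indicators for inputs and for the acceptance effect — lies in `ℤ[ω]`
(`ω = e^{iπ/4}`) once the tensor of each Hadamard gate is doubled (`(±1/√2)(±1/√2) = ±1/2`).
This file writes those tables in the coordinates `ZW = Fin 4 → ℤ` of `StateVectorDP.lean` /
`ZWRing.lean` (the format the machine computes with) and relates them to the network:

* `zwGateEntry g yk xk yb xb` — the doubled/integral entry of the superoperator tensor of a
  placed Clifford+`T` gate at output/input ket bits `yk, xk` and bra bits `yb, xb` (read on the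
  gate's own wires only: `H`: `±1`; `S`, `T`: `ω^{2a+6a'}`, `ω^{a+7a'}` on the diagonal; `CNOT`:
  the `0/1` permutation pattern); **`zwVal_zwGateEntry`**: its value is
  `2^{[g = H]} · (U_g)_{yk,xk} · conj (U_g)_{yb,xb}` whenever the registers agree off the gate;
* `zwEntry C z₀ w₀ u b` — the table of the node `u` of `N(C; z₀, τ)` for the acceptance effect
  on wire `w₀` (`accObs w₀`); **`zwVal_zwEntry`**: `= 2^{hWeight u} · entry u b`;
* `scaledNetwork C z₀ w₀` — the network with entries `zwVal ∘ zwEntry` (same scopes), and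
  **`value_scaledNetwork`**: its value is `2^{hCount C.gates} ·` the value of the segment
  network, hence (`value_scaledNetwork_acceptProb`) `2^{h} · P[wire 0 reads 1]`;
* the read-out **`acceptProb_readout`**: if `zwVal Z = 2^h · p` then
  `p · 2^{h+1} = 2 Z₀ + (Z₁ − Z₃)√2` (`ZW.zwVal_re`) — the `probCode` of the engine.

## References

* [MarkovShi2008] I. L. Markov, Y. Shi, SIAM J. Comput. 38 (2008) 963–981
  (arXiv:quant-ph/0511069), §3 (Def 3.2: the tensor of a superoperator; the network
  `N(C; x, τ)`; Prop 3.5), §4 (proof of Thm 4.6, Step 4). Read via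
  `lit read paper:arxiv-quant-ph_0511069` (pp. 7–10).
* M. A. Nielsen, I. L. Chuang, *Quantum Computation and Quantum Information*, CUP 2010, §4.2
  (the matrices of `H`, `S`, `T`, `CNOT`).
-/

noncomputable section

namespace Literature.Barriers.QuantumAdvantage

open Literature.Computability.Cryptography Literature.Computability.QuantumComplexity
  Literature.LinearAlgebra.TensorNetworks ZW

variable {N : ℕ}

/-! ### The integral gate tables -/

/-- `[b]` as a natural number. [folklore] -/
def bit (b : Bool) : ℕ := if b then 1 else 0

/-- **The doubled/integral entry of the superoperator tensor of a placed Clifford+`T` gate**,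
at output ket bits `yk`, input ket bits `xk`, output bra bits `yb`, input bra bits `xb` (read on
the gate's wires): `H` on `w`: `(−1)^{yk w · xk w + yb w · xb w}` (twice
`(±1/√2)(±1/√2)`); `S` on `w`: `[yk w = xk w][yb w = xb w] ω^{2[xk w] + 6[xb w]}`; `T`:
`… ω^{[xk w] + 7[xb w]}`; `CNOT` (control `e 0`, target `e 1`): the indicator of
`yk = CNOT xk ∧ yb = CNOT xb` on the two wires. Oracle gates (absent): `0`.
[cite: MarkovShi2008, §3 (Def 3.2: Q_{σ,τ} = tr(Q(σ) τ†))] -/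
def zwGateEntry : QGate cliffordT N → (yk xk yb xb : QReg N) → ZW
  | .gate .H e, yk, xk, yb, xb =>
      if ((yk (e (0 : Fin 1)) && xk (e (0 : Fin 1))) ^^ (yb (e (0 : Fin 1)) && xb (e (0 : Fin 1))))
      then -ZW.one else ZW.one
  | .gate .S e, yk, xk, yb, xb =>
      if yk (e (0 : Fin 1)) = xk (e (0 : Fin 1)) ∧ yb (e (0 : Fin 1)) = xb (e (0 : Fin 1)) then
        mulOmegaPow (2 * bit (xk (e (0 : Fin 1))) + 6 * bit (xb (e (0 : Fin 1)))) ZW.one else 0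
  | .gate .T e, yk, xk, yb, xb =>
      if yk (e (0 : Fin 1)) = xk (e (0 : Fin 1)) ∧ yb (e (0 : Fin 1)) = xb (e (0 : Fin 1)) then
        mulOmegaPow (bit (xk (e (0 : Fin 1))) + 7 * bit (xb (e (0 : Fin 1)))) ZW.one else 0
  | .gate .CNOT e, yk, xk, yb, xb =>
      if (yk (e (0 : Fin 2)) = xk (e (0 : Fin 2)) ∧ yk (e (1 : Fin 2)) = (xk (e (1 : Fin 2)) ^^ xk (e (0 : Fin 2)))) ∧
          (yb (e (0 : Fin 2)) = xb (e (0 : Fin 2)) ∧ yb (e (1 : Fin 2)) = (xb (e (1 : Fin 2)) ^^ xb (e (0 : Fin 2))))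
      then ZW.one else 0
  | .oracle _ _, _, _, _, _ => 0

/-- The weight of a gate in the power of two carried by the tables: `1` for `H`, else `0`.
[folklore] -/
def hWeightGate (g : QGate cliffordT N) : ℕ := if QGateIsH g then 1 else 0

/-- `zwVal (-1) = -1`. [folklore] -/
theorem zwVal_neg_one : zwVal (-ZW.one) = -1 := by rw [zwVal_neg, zwVal_one]

/-- `2 · (1/√2) · (1/√2) = 1`. [folklore] -/
theorem two_mul_invSqrt2_mul_invSqrt2 : (2 : ℂ) * (invSqrt2 * invSqrt2) = 1 := by
  rw [invSqrt2_mul_invSqrt2]; norm_num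

/-- `conj ω = ω⁷`. [folklore] -/
theorem conj_omega_eq_pow_seven : starRingEnd ℂ omega = omega ^ 7 := by
  rw [conj_omega]
  have h4 : omega ^ 4 = -1 := omega_pow_four
  calc -omega ^ 3 = omega ^ 4 * omega ^ 3 := by rw [h4]; ring
    _ = omega ^ 7 := by ring

/-- `ω⁶ = −i`. [folklore] -/
theorem omega_pow_six : omega ^ 6 = -Complex.I := by
  rw [show (6 : ℕ) = 4 + 2 from rfl, pow_add, omega_pow_four, omega_pow_two]; ring

/-- The entries of `hGate` as `±1/√2` of the and of the two bits. [folklore] -/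
theorem hGate_apply_and (x y : QReg 1) : hGate x y = if (x 0 && y 0) then -invSqrt2 else invSqrt2 := by
  change (if x 0 = true ∧ y 0 = true then -(1 / (Real.sqrt 2 : ℂ)) else 1 / (Real.sqrt 2 : ℂ)) = _
  cases x 0 <;> cases y 0 <;> simp

/-- The entries of `hGate` are real. [folklore] -/
theorem conj_hGate (x y : QReg 1) : starRingEnd ℂ (hGate x y) = hGate x y := by
  rw [hGate_apply_and]
  split_ifs <;> simp

/-- The doubled product of two `H` entries: `2 (±1/√2)(±1/√2) = ∓±1`. [folklore] -/
theorem zwVal_hSign (s s' : Bool) :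
    zwVal (if (s ^^ s') then -ZW.one else ZW.one) =
      2 * ((if s then -invSqrt2 else invSqrt2) * (if s' then -invSqrt2 else invSqrt2)) := by
  have h := two_mul_invSqrt2_mul_invSqrt2
  cases s <;> cases s'
  · show zwVal ZW.one = 2 * (invSqrt2 * invSqrt2)
    rw [zwVal_one]; linear_combination (-1 : ℂ) * h
  · show zwVal (-ZW.one) = 2 * (invSqrt2 * -invSqrt2)
    rw [zwVal_neg_one]; linear_combination (1 : ℂ) * h
  · show zwVal (-ZW.one) = 2 * (-invSqrt2 * invSqrt2)
    rw [zwVal_neg_one]; linear_combination (1 : ℂ) * h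
  · show zwVal ZW.one = 2 * (-invSqrt2 * -invSqrt2)
    rw [zwVal_one]; linear_combination (-1 : ℂ) * h

/-- The product of two `S` entries: `i^{a} · conj (i^{a'}) = ω^{2a + 6a'}`. [folklore] -/
theorem sEntry_mul_conj (a a' : Bool) :
    (if a then Complex.I else 1) * starRingEnd ℂ (if a' then Complex.I else 1) =
      omega ^ (2 * bit a + 6 * bit a') := by
  cases a <;> cases a'
  · simp [bit]
  · show (1 : ℂ) * starRingEnd ℂ Complex.I = omega ^ (2 * 0 + 6 * 1)
    rw [Complex.conj_I]; norm_num [omega_pow_six]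
  · show Complex.I * starRingEnd ℂ 1 = omega ^ (2 * 1 + 6 * 0)
    rw [map_one]; norm_num [omega_pow_two]
  · show Complex.I * starRingEnd ℂ Complex.I = omega ^ (2 * 1 + 6 * 1)
    rw [Complex.conj_I]; norm_num [omega_pow_eight]

/-- The product of two `T` entries: `ω^{a} · conj (ω^{a'}) = ω^{a + 7a'}`. [folklore] -/
theorem tEntry_mul_conj (a a' : Bool) :
    (if a then omega else 1) * starRingEnd ℂ (if a' then omega else 1) =
      omega ^ (bit a + 7 * bit a') := by
  cases a <;> cases a'
  · simp [bit]
  · show (1 : ℂ) * starRingEnd ℂ omega = omega ^ (0 + 7 * 1)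
    rw [conj_omega_eq_pow_seven]; norm_num
  · show omega * starRingEnd ℂ 1 = omega ^ (1 + 7 * 0)
    rw [map_one]; norm_num
  · show omega * starRingEnd ℂ omega = omega ^ (1 + 7 * 1)
    rw [conj_omega_eq_pow_seven]; ring

/-- A function on `Fin 1` is determined by its value at `0`. [folklore] -/
theorem funext_fin_one {x y : QReg 1} : x = y ↔ x 0 = y 0 :=
  ⟨fun h => by rw [h], fun h => funext fun i => by rw [Subsingleton.elim i 0]; exact h⟩

/-- Off the wires of a placed gate symbol: `i ∉ range e` means `i ∉ wires`. [folklore] -/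
theorem not_mem_wires_of_not_mem_range {op : CliffordTOp} {e : Fin (cliffordT.arity op) ↪ Fin N}
    {i : Fin N} (hi : i ∉ Set.range e) : i ∉ (QGate.gate op e : QGate cliffordT N).wires := by
  intro h
  simp only [QGate.wires, Finset.mem_map, Finset.mem_univ, true_and] at h
  obtain ⟨j, hj⟩ := h
  exact hi ⟨j, hj⟩

/-- **The integral gate tables are the doubled superoperator entries**: for an oracle-free
placed gate `g` and registers agreeing off the gate's wires,
`zwVal (zwGateEntry g yk xk yb xb) = 2^{[g = H]} · (U_g)_{yk,xk} · conj (U_g)_{yb,xb}`.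
[cite: MarkovShi2008, §3 (Def 3.2)] -/
theorem zwVal_zwGateEntry (A : Language Bool) {g : QGate cliffordT N} (hg : g.IsOracleFree)
    {yk xk yb xb : QReg N} (hk : ∀ i ∉ g.wires, yk i = xk i) (hb : ∀ i ∉ g.wires, yb i = xb i) :
    zwVal (zwGateEntry g yk xk yb xb) =
      (2 : ℂ) ^ hWeightGate g * (g.toMatrix A yk xk * starRingEnd ℂ (g.toMatrix A yb xb)) := by
  cases g with
  | oracle k e => exact absurd hg id
  | gate op e =>
    have hk' : ∀ i, i ∉ Set.range e → yk i = xk i := fun i hi => hk i (not_mem_wires_of_not_mem_range hi)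
    have hb' : ∀ i, i ∉ Set.range e → yb i = xb i := fun i hi => hb i (not_mem_wires_of_not_mem_range hi)
    rw [QGate.toMatrix_gate, placeGate_apply, placeGate_apply, if_pos hk', if_pos hb']
    cases op with
    | H =>
      have h2 : (2 : ℂ) ^ hWeightGate (QGate.gate CliffordTOp.H e : QGate cliffordT N) = 2 := by
        simp [hWeightGate, QGateIsH]
      rw [h2]
      change zwVal (if ((yk (e (0 : Fin 1)) && xk (e (0 : Fin 1))) ^^ (yb (e (0 : Fin 1)) && xb (e (0 : Fin 1)))) then -ZW.one else ZW.one) =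
        2 * (hGate (yk ∘ e) (xk ∘ e) * starRingEnd ℂ (hGate (yb ∘ e) (xb ∘ e)))
      rw [conj_hGate, hGate_apply_and, hGate_apply_and]
      exact zwVal_hSign _ _
    | S =>
      have h2 : (2 : ℂ) ^ hWeightGate (QGate.gate CliffordTOp.S e : QGate cliffordT N) = 1 := by
        simp [hWeightGate, QGateIsH]
      rw [h2, one_mul]
      change zwVal (if yk (e (0 : Fin 1)) = xk (e (0 : Fin 1)) ∧ yb (e (0 : Fin 1)) = xb (e (0 : Fin 1)) then
          mulOmegaPow (2 * bit (xk (e (0 : Fin 1))) + 6 * bit (xb (e (0 : Fin 1)))) ZW.one else 0) =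
        sGate (yk ∘ e) (xk ∘ e) * starRingEnd ℂ (sGate (yb ∘ e) (xb ∘ e))
      simp only [sGate, Matrix.of_apply, funext_fin_one, Function.comp_apply]
      by_cases h1 : yk (e (0 : Fin 1)) = xk (e (0 : Fin 1))
      · by_cases h3 : yb (e (0 : Fin 1)) = xb (e (0 : Fin 1))
        · rw [if_pos ⟨h1, h3⟩, if_pos h1, if_pos h3, zwVal_mulOmegaPow_one]
          simp only [h1, h3]
          exact (sEntry_mul_conj _ _).symm
        · rw [if_neg (fun h => h3 h.2), if_neg h3, zwVal_zero, map_zero, mul_zero]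
      · rw [if_neg (fun h => h1 h.1), if_neg h1, zwVal_zero, zero_mul]
    | T =>
      have h2 : (2 : ℂ) ^ hWeightGate (QGate.gate CliffordTOp.T e : QGate cliffordT N) = 1 := by
        simp [hWeightGate, QGateIsH]
      rw [h2, one_mul]
      change zwVal (if yk (e (0 : Fin 1)) = xk (e (0 : Fin 1)) ∧ yb (e (0 : Fin 1)) = xb (e (0 : Fin 1)) then
          mulOmegaPow (bit (xk (e (0 : Fin 1))) + 7 * bit (xb (e (0 : Fin 1)))) ZW.one else 0) =
        tGate (yk ∘ e) (xk ∘ e) * starRingEnd ℂ (tGate (yb ∘ e) (xb ∘ e))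
      simp only [tGate, Matrix.of_apply, funext_fin_one, Function.comp_apply]
      by_cases h1 : yk (e (0 : Fin 1)) = xk (e (0 : Fin 1))
      · by_cases h3 : yb (e (0 : Fin 1)) = xb (e (0 : Fin 1))
        · rw [if_pos ⟨h1, h3⟩, if_pos h1, if_pos h3, zwVal_mulOmegaPow_one]
          simp only [h1, h3]
          exact (tEntry_mul_conj _ _).symm
        · rw [if_neg (fun h => h3 h.2), if_neg h3, zwVal_zero, map_zero, mul_zero]
      · rw [if_neg (fun h => h1 h.1), if_neg h1, zwVal_zero, zero_mul]
    | CNOT =>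
      have h2 : (2 : ℂ) ^ hWeightGate (QGate.gate CliffordTOp.CNOT e : QGate cliffordT N) = 1 := by
        simp [hWeightGate, QGateIsH]
      rw [h2, one_mul]
      change zwVal (if (yk (e (0 : Fin 2)) = xk (e (0 : Fin 2)) ∧ yk (e (1 : Fin 2)) = (xk (e (1 : Fin 2)) ^^ xk (e (0 : Fin 2)))) ∧
            (yb (e (0 : Fin 2)) = xb (e (0 : Fin 2)) ∧ yb (e (1 : Fin 2)) = (xb (e (1 : Fin 2)) ^^ xb (e (0 : Fin 2)))) then ZW.one else 0) =
        cnot (yk ∘ e) (xk ∘ e) * starRingEnd ℂ (cnot (yb ∘ e) (xb ∘ e))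
      simp only [cnot, Matrix.of_apply, Function.comp_apply]
      by_cases h1 : yk (e (0 : Fin 2)) = xk (e (0 : Fin 2)) ∧ yk (e (1 : Fin 2)) = (xk (e (1 : Fin 2)) ^^ xk (e (0 : Fin 2)))
      · by_cases h3 : yb (e (0 : Fin 2)) = xb (e (0 : Fin 2)) ∧ yb (e (1 : Fin 2)) = (xb (e (1 : Fin 2)) ^^ xb (e (0 : Fin 2)))
        · rw [if_pos ⟨h1, h3⟩, if_pos h1, if_pos h3, zwVal_one, map_one, mul_one]
        · rw [if_neg (fun h => h3 h.2), if_neg h3, zwVal_zero, map_zero, mul_zero]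
      · rw [if_neg (fun h => h1 h.1), if_neg h1, zwVal_zero, zero_mul]

/-! ### The tables of the nodes of `N(C; z₀, τ)` -/

/-- The acceptance effect on wire `w₀` (indicator of `1`), all other wires traced out —
Markov–Shi's measurement scenario `τ` for "wire `w₀` reads `1`". [cite: MarkovShi2008, §3 (Def 3.4)] -/
def accObs (w₀ : Fin N) : Fin N → Bool → ℂ := fun w b => if w = w₀ then (if b then 1 else 0) else 1

/-- The integral table of the acceptance effect. [cite: MarkovShi2008, §3 (Def 3.4)] -/
def zwObs (w₀ w : Fin N) (b : Bool) : ZW := if w = w₀ then (if b then ZW.one else 0) else ZW.one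

/-- `zwObs` is `accObs`. [folklore] -/
theorem zwVal_zwObs (w₀ w : Fin N) (b : Bool) : zwVal (zwObs w₀ w b) = accObs w₀ w b := by
  unfold zwObs accObs
  split_ifs <;> simp

/-- **The integral table of a node of the segment network** `N(C; z₀, τ)` (`τ` = acceptance on
`w₀`): inputs and outputs as indicators, the gate `t` through `zwGateEntry` on the register
snapshots before/after it (`ketAt`/`braAt`). [cite: MarkovShi2008, §3 (the network N(C; x, τ))] -/
def zwEntry (C : QCircuit cliffordT N) (z₀ : QReg N) (w₀ : Fin N) :
    CircuitNode C.gates.length N → (Seg C → Bool × Bool) → ZW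
  | .input w, b => if b (segAt C w 0) = (z₀ w, z₀ w) then ZW.one else 0
  | .gate t, b => zwGateEntry (C.gates[(t : ℕ)]) (ketAt b t.succ) (ketAt b t.castSucc)
      (braAt b t.succ) (braAt b t.castSucc)
  | .output w, b =>
      if (b (segAt C w (Fin.last _))).1 = (b (segAt C w (Fin.last _))).2 then
        zwObs w₀ w (b (segAt C w (Fin.last _))).1 else 0

/-- The power of two carried by the table of a node: `1` at Hadamard gates, else `0`. [folklore] -/
def hWeight (C : QCircuit cliffordT N) : CircuitNode C.gates.length N → ℕ
  | .gate t => hWeightGate (C.gates[(t : ℕ)])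
  | _ => 0

/-- Register snapshots across a gate agree off its wires (idle wires keep their segment).
[folklore] -/
theorem ketAt_succ_eq_of_not_mem {G : QGateSet} {C : QCircuit G N} (b : Seg C → Bool × Bool)
    (t : Fin C.gates.length) {i : Fin N} (hi : i ∉ (C.gates[(t : ℕ)]).wires) :
    ketAt b t.succ i = ketAt b t.castSucc i ∧ braAt b t.succ i = braAt b t.castSucc i := by
  simp only [ketAt, braAt, segAt_succ_of_not_mem t hi, and_self]

/-- **The integral tables are the entries of the segment network, doubled at `H` gates**:
`zwVal (zwEntry C z₀ w₀ u b) = 2^{hWeight u} · entry u b` for oracle-free `C`.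
[cite: MarkovShi2008, §3 (Def 3.2, the network N(C; x, τ))] -/
theorem zwVal_zwEntry {C : QCircuit cliffordT N} (hC : C.IsOracleFree) (A : Language Bool)
    (z₀ : QReg N) (w₀ : Fin N) (u : CircuitNode C.gates.length N) (b : Seg C → Bool × Bool) :
    zwVal (zwEntry C z₀ w₀ u b) = (2 : ℂ) ^ hWeight C u * (segmentNetwork C A z₀ (accObs w₀)).entry u b := by
  cases u with
  | input w =>
    simp only [zwEntry, hWeight, pow_zero, one_mul, segmentNetwork]
    split_ifs <;> simp
  | gate t =>
    simp only [zwEntry, hWeight, segmentNetwork]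
    exact zwVal_zwGateEntry A (hC _ (List.getElem_mem t.isLt))
      (fun i hi => (ketAt_succ_eq_of_not_mem b t hi).1) (fun i hi => (ketAt_succ_eq_of_not_mem b t hi).2)
  | output w =>
    simp only [zwEntry, hWeight, pow_zero, one_mul, segmentNetwork]
    split_ifs <;> simp [zwVal_zwObs]

/-- The integral tables depend only on the scope of their node. [folklore] -/
theorem zwEntry_congr {C : QCircuit cliffordT N} (hC : C.IsOracleFree) (z₀ : QReg N) (w₀ : Fin N)
    (u : CircuitNode C.gates.length N) {a b : Seg C → Bool × Bool}
    (hab : ∀ s ∈ (segmentNetwork C 0 z₀ (accObs w₀)).scope u, a s = b s) :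
    zwEntry C z₀ w₀ u a = zwEntry C z₀ w₀ u b := by
  apply zwVal_injective
  rw [zwVal_zwEntry hC 0, zwVal_zwEntry hC 0, (segmentNetwork C 0 z₀ (accObs w₀)).entry_congr u hab]

/-! ### The scaled network and its value -/

/-- **The scaled segment network**: same scopes as `N(C; z₀, τ)`, entries the values of the
integral tables (so this complex network is literally the image of what the machine computes).
[cite: MarkovShi2008, §3 (the network N(C; x, τ)) and §4 (proof of Thm 4.6, Step 4)] -/
def scaledNetwork (C : QCircuit cliffordT N) (hC : C.IsOracleFree) (z₀ : QReg N) (w₀ : Fin N) :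
    TensorNetwork ℂ (Seg C) (Bool × Bool) (CircuitNode C.gates.length N) where
  scope := (segmentNetwork C 0 z₀ (accObs w₀)).scope
  entry u b := zwVal (zwEntry C z₀ w₀ u b)
  entry_congr u _ _ hab := by rw [zwEntry_congr hC z₀ w₀ u hab]

/-- The total power of two: `Σ_u hWeight u = hCount C.gates` (the number of `H` gates). [folklore] -/
theorem sum_hWeight (C : QCircuit cliffordT N) : ∑ u, hWeight C u = hCount C.gates := by
  rw [← (circuitNodeEquivSum C.gates.length N).symm.sum_comp, Fintype.sum_sum_type,
    Fintype.sum_sum_type]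
  simp only [circuitNodeEquivSum, Equiv.coe_fn_symm_mk, hWeight, Finset.sum_const_zero, zero_add,
    add_zero]
  have h := card_filter_univ_fin_eq_countP C.gates (fun g => QGateIsH g = true)
  simp only [Bool.decide_eq_true] at h
  rw [hCount, ← h, Finset.card_filter]
  rfl

/-- **The value of the scaled network is `2^{h}` times the value of `N(C; z₀, τ)`**, `h` the
number of Hadamard gates. [cite: MarkovShi2008, §3 (Prop 3.5) and §4 (Step 4)] -/
theorem value_scaledNetwork {C : QCircuit cliffordT N} (hC : C.IsOracleFree) (z₀ : QReg N) (w₀ : Fin N) :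
    (scaledNetwork C hC z₀ w₀).value =
      (2 : ℂ) ^ hCount C.gates * (segmentNetwork C 0 z₀ (accObs w₀)).value := by
  unfold TensorNetwork.value
  rw [Finset.mul_sum]
  refine Finset.sum_congr rfl fun b _ => ?_
  change ∏ u, zwVal (zwEntry C z₀ w₀ u b) = _
  simp_rw [zwVal_zwEntry hC 0 z₀ w₀ _ b]
  rw [Finset.prod_mul_distrib, Finset.prod_pow_eq_pow_sum, sum_hWeight]

/-- **`2^h · P[wire 0 reads 1]` is the value of the scaled network** of the circuit run on
`|x⟩|0^m⟩` (Prop 3.5, `acceptProb_eq_value_segmentNetwork`). [cite: MarkovShi2008, §3 (Prop 3.5)] -/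
theorem value_scaledNetwork_acceptProb {n m : ℕ} {C : QCircuit cliffordT (n + m)} (hC : C.IsOracleFree)
    (x : QReg n) (h : 0 < n + m) :
    (scaledNetwork C hC (padInput x m) ⟨0, h⟩).value = (2 : ℂ) ^ hCount C.gates * (C.acceptProb 0 x : ℂ) := by
  rw [value_scaledNetwork hC, acceptProb_eq_value_segmentNetwork 0 C x h]
  rfl

/-! ### Reading the probability off the contracted value -/

/-- **Read-out of the probability**: if the contracted integral value `Z ∈ ℤ[ω]` satisfies
`zwVal Z = 2^h · p` for a real `p`, then `p · 2^{h+1} = 2 Z₀ + (Z₁ − Z₃)·√2` — the exact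
dyadic form `probCode (2 Z₀) (Z₁ − Z₃) (h + 1)` returned by the engine (`ZW.zwVal_re`:
`re (zwVal Z) = Z₀ + (Z₁ − Z₃)√2/2`). [folklore] -/
theorem acceptProb_readout {Z : ZW} {p : ℝ} {h : ℕ} (hZ : zwVal Z = (2 : ℂ) ^ h * (p : ℂ)) :
    p * 2 ^ (h + 1) = ((2 * Z 0 : ℤ) : ℝ) + ((Z 1 - Z 3 : ℤ) : ℝ) * Real.sqrt 2 := by
  have hre := zwVal_re Z
  rw [hZ] at hre
  have h2 : ((2 : ℂ) ^ h * (p : ℂ)).re = 2 ^ h * p := by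
    rw [show (2 : ℂ) ^ h * (p : ℂ) = ((2 ^ h * p : ℝ) : ℂ) by push_cast; ring]
    exact Complex.ofReal_re _
  rw [h2] at hre
  push_cast
  rw [pow_succ]
  nlinarith [hre]

end Literature.Barriers.QuantumAdvantage

end
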